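import Literature.Computability.QuantumComplexity.FieldThresholds
import Literature.Computability.QuantumComplexity.GaussianCellsAngles
import HarnessLib

/-!
# The sign predicate of the Grover–Rudolph level rotation from ONE field of the label

Topic `Literature/Computability/QuantumComplexity`, sequel of `FieldThresholds.lean`. The assembled
rotation gadget (`GadgetAssemblyGen.rotGadget_implOn_gen`) asks for the entry bound on EVERY label and
for a unitary ideal block on every label; so the block and both of its entries must be functions of one
and the same field `F` of the label (the `k`-bit word written by the reversible computation of the
level's cosine; Regev 2009, Lemma 3.12: Grover–Rudolph state preparation). With `ã = 1 − 2F/2^k` the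
ideal block is `rotC ã = [[ã, −s̃], [s̃, ã]]`, `s̃ = √(1 − ã²)` (`GaussianCells.rotC`), and:

* the diagonal entry `−ã` is encoded exactly by `.not (ltFieldB k o)` (`FieldThresholds.lean`);
* **`SLP.sOffB k o`** — the off-diagonal threshold `n < 2^{k−1}(1 − s̃)` written WITHOUT square roots as
  the semialgebraic condition `n ≤ 2^{k−1} ∧ 2^k·n + 2^k·F < n² + F² + 4^{k−1}` (`sOffB_eval_iff`);
  hence (`encodesEntryAt_of_threshold`, the local form of `encodesEntry_of_threshold`)
  **`SLP.encodesEntryAt_sOffB`**: it encodes `s̃` at the label, and its negation `−s̃`;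
* **`SLP.grLevelB k o`** `= rotSignB k (trueB (k+2)) (¬ltFieldB) (¬sOffB) sOffB` and
  **`SLP.grLevel_entry_bound`**: on every label the gadget quantity is within `2/2^k` of the entry of
  `−rotC ã` (`rotSign_entry_bound_at`); `rotC_mem_unitaryGroup'` (`|ã| ≤ 1` suffices).

Everything here is proved; definitions have bodies; no named fact is introduced.

## References

* L. Grover, T. Rudolph, *Creating superpositions that correspond to efficiently integrable probability
  distributions*, arXiv:quant-ph/0208112 (2002), eq. (4)–(5) [GroverRudolph2002].
* O. Regev, J. ACM 56 (2009), art. 34, Lemma 3.12 (proof), §2 p. 11 [Regev2009].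
* D. Aharonov, V. Jones, Z. Landau, Algorithmica 55 (2009), Claim 4.1, Thm. 4.3 [AharonovJonesLandau2009].
-/

noncomputable section

namespace Literature.Computability.QuantumComplexity

namespace SLP

open Real Finset GaussianCells

/-! ### Local threshold encodings -/

/-- **Local threshold predicates encode `1 − 2τ`** (the proof of `encodesEntry_of_threshold` at one
label). [folklore] -/
theorem encodesEntryAt_of_threshold {k : ℕ} {p : BExpr} {τ : ℝ} {rest : ℕ} (h0 : 0 ≤ τ) (h1 : τ ≤ 1)
    (hp : ∀ (bb zt : Bool) (n : ℕ), n < 2 ^ k → p.eval (2 ^ k * hiOf bb zt rest + n) = decide ((n : ℝ) < 2 ^ k * τ)) :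
    EncodesEntryAt k p (1 - 2 * τ) rest := by
  intro bb zt
  have hc : cnt k p (hiOf bb zt rest) = ((Finset.range (2 ^ k)).filter fun a : ℕ => (a : ℝ) < 2 ^ k * τ).card := by
    unfold cnt
    congr 1
    refine Finset.filter_congr fun n hn => ?_
    rw [hp bb zt n (Finset.mem_range.1 hn), decide_eq_true_iff]
  have hk : (0 : ℝ) < 2 ^ k := by positivity
  have := card_filter_lt_real k h0 h1
  rw [hc]
  rw [show (1 - 2 * (((Finset.range (2 ^ k)).filter fun a : ℕ => (a : ℝ) < 2 ^ k * τ).card : ℝ) / 2 ^ k) - (1 - 2 * τ) =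
    (-2 / 2 ^ k) * ((((Finset.range (2 ^ k)).filter fun a : ℕ => (a : ℝ) < 2 ^ k * τ).card : ℝ) - 2 ^ k * τ) by field_simp; ring]
  rw [abs_mul, abs_div, abs_neg, abs_two, abs_of_pos hk]
  calc 2 / 2 ^ k * |((((Finset.range (2 ^ k)).filter fun a : ℕ => (a : ℝ) < 2 ^ k * τ).card : ℝ)) - 2 ^ k * τ|
      ≤ 2 / 2 ^ k * 1 := mul_le_mul_of_nonneg_left this (by positivity)
    _ = 2 / 2 ^ k := mul_one _

/-- **Negation negates the locally encoded entry.** [folklore] -/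
theorem EncodesEntryAt.not {k : ℕ} {p : BExpr} {v : ℝ} {rest : ℕ} (h : EncodesEntryAt k p v rest) : EncodesEntryAt k (.not p) (-v) rest := by
  intro bb zt
  have hc : (cnt k (.not p) (hiOf bb zt rest) : ℝ) = 2 ^ k - cnt k p (hiOf bb zt rest) := by
    unfold cnt
    have := Finset.card_filter_add_card_filter_not (s := Finset.range (2 ^ k)) (fun n => p.eval (2 ^ k * hiOf bb zt rest + n) = true)
    rw [Finset.card_range] at this
    have e : ((Finset.range (2 ^ k)).filter fun n => (BExpr.not p).eval (2 ^ k * hiOf bb zt rest + n) = true) =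
        (Finset.range (2 ^ k)).filter fun n => ¬ p.eval (2 ^ k * hiOf bb zt rest + n) = true := Finset.filter_congr fun n _ => by simp [BExpr.eval]
    rw [e]
    have := congrArg (fun m : ℕ => (m : ℝ)) this
    push_cast at this ⊢
    linarith
  rw [hc]
  have := h bb zt
  rw [show (1 - 2 * ((2 : ℝ) ^ k - cnt k p (hiOf bb zt rest)) / 2 ^ k) - -v = -((1 - 2 * (cnt k p (hiOf bb zt rest) : ℝ) / 2 ^ k) - v) by
    field_simp; ring, abs_neg]
  exact this

/-! ### The encoded cosine and sine -/

/-- **The encoded cosine** `ã = 1 − 2F/2^k`. [cite: GroverRudolph2002, eq. (4)] -/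
def aTil (k F : ℕ) : ℝ := 1 - 2 * (F : ℝ) / 2 ^ k

/-- **The encoded sine** `s̃ = √(1 − ã²)`. [cite: GroverRudolph2002, eq. (4)] -/
def sTil (k F : ℕ) : ℝ := Real.sqrt (1 - aTil k F ^ 2)

/-- `|ã| ≤ 1` for `F ≤ 2^k`. [folklore] -/
theorem abs_aTil_le {k F : ℕ} (hF : F ≤ 2 ^ k) : |aTil k F| ≤ 1 := by
  unfold aTil
  have hk : (0 : ℝ) < 2 ^ k := by positivity
  have hF' : (F : ℝ) ≤ 2 ^ k := by exact_mod_cast hF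
  rw [abs_le]
  constructor
  · rw [show (1 : ℝ) - 2 * F / 2 ^ k = (2 ^ k - 2 * F) / 2 ^ k by field_simp]
    rw [le_div_iff₀ hk]; nlinarith
  · have : (0 : ℝ) ≤ 2 * F / 2 ^ k := by positivity
    linarith

/-- `0 ≤ s̃ ≤ 1`. [folklore] -/
theorem sTil_mem (k F : ℕ) : 0 ≤ sTil k F ∧ sTil k F ≤ 1 := by
  refine ⟨Real.sqrt_nonneg _, ?_⟩
  unfold sTil
  rw [Real.sqrt_le_one]
  nlinarith [sq_nonneg (aTil k F)]

/-- `ã² + s̃² = 1` for `F ≤ 2^k`. [folklore] -/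
theorem aTil_sq_add_sTil_sq {k F : ℕ} (hF : F ≤ 2 ^ k) : aTil k F ^ 2 + sTil k F ^ 2 = 1 := by
  unfold sTil
  have h := abs_aTil_le (k := k) hF
  rw [abs_le] at h
  rw [Real.sq_sqrt (by nlinarith)]
  ring

/-- **`rotC a` is unitary for `|a| ≤ 1`** (the proof of `rotC_mem_unitaryGroup` uses only `a² ≤ 1`). [folklore] -/
theorem rotC_mem_unitaryGroup' {a : ℝ} (ha : |a| ≤ 1) : rotC a ∈ Matrix.unitaryGroup (Cryptography.QReg 1) ℂ := by
  rw [abs_le] at ha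
  have hs : a ^ 2 + Real.sqrt (1 - a ^ 2) ^ 2 = 1 := by
    rw [Real.sq_sqrt (by nlinarith)]; ring
  unfold rotC
  rw [Matrix.mem_unitaryGroup_iff]
  ext x z
  simp only [Matrix.mul_apply, Matrix.star_apply, Matrix.of_apply, Matrix.one_apply, RCLike.star_def]
  rw [Fintype.sum_eq_add (fun _ => false) (fun _ => true) (by intro e; have := congrFun e 0; simp at this)
    (by intro w hw; exfalso
        cases hw0 : w 0
        · exact hw.1 (GroverRudolph.qreg_one_ext hw0)
        · exact hw.2 (GroverRudolph.qreg_one_ext hw0))]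
  have keyC : (a : ℂ) * a + (Real.sqrt (1 - a ^ 2) : ℂ) * Real.sqrt (1 - a ^ 2) = 1 := by
    have := congrArg (fun r : ℝ => (r : ℂ)) hs; push_cast at this; linear_combination this
  by_cases hxz : x = z
  · subst hxz
    rw [if_pos rfl]
    cases hx : x 0 <;> simp [Complex.conj_ofReal] <;> linear_combination keyC
  · rw [if_neg hxz]
    have hne : x 0 ≠ z 0 := fun e => hxz (GroverRudolph.qreg_one_ext e)
    cases hx : x 0 <;> cases hz : z 0 <;> simp_all [Complex.conj_ofReal] <;> ring

/-! ### The off-diagonal threshold without square roots -/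

/-- **The off-diagonal sign predicate**: `n ≤ 2^{k−1} ∧ 2^k·n + 2^k·F < n² + F² + 4^{k−1}`, the field
`F` at offset `o` (`k ≥ 1`). [cite: GroverRudolph2002, eq. (5)] -/
def sOffB (k o : ℕ) : BExpr :=
  .and (.lt (aE k) (.add (.pw (k - 1)) (.pw 0) 0))
    (.lt (.add (shlE (aE k) k) (.fld (k + 2 + o) k) k)
      (.add (.add (.mul (aE k) (aE k)) (.mul (.fld (k + 2 + o) k) (.fld (k + 2 + o) k)) 0) (.pw (2 * (k - 1))) 0))

/-- The arithmetic of `sOffB` on a gadget input. [folklore] -/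
theorem sOffB_eval (k o : ℕ) (bb zt : Bool) (rest : ℕ) {n : ℕ} (hn : n < 2 ^ k) :
    (sOffB k o).eval (2 ^ k * hiOf bb zt rest + n) =
      (decide (n < 2 ^ (k - 1) + 1) && decide (n * 2 ^ k + fieldVal k o rest * 2 ^ k <
        n * n + fieldVal k o rest * fieldVal k o rest + 2 ^ (2 * (k - 1)))) := by
  have hF : (2 ^ k * hiOf bb zt rest + n) / 2 ^ (k + 2 + o) % 2 ^ k = fieldVal k o rest := fld_eval_gadgetInput k o bb zt rest hn
  have ha : (2 ^ k * hiOf bb zt rest + n) % 2 ^ k = n := mod_field hn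
  simp only [sOffB, BExpr.eval, AExpr.eval, shlE, zeroE, aE, hF, pow_zero, Nat.div_one, Nat.mod_one, zero_add, mul_one, ha]

/-- **The semialgebraic condition is the threshold `n < 2^{k−1}(1 − s̃)`** (`k ≥ 1`, `n < 2^k`, `F < 2^k`).
[cite: GroverRudolph2002, eq. (5)] -/
theorem sOff_iff {k : ℕ} (hk : 1 ≤ k) {n F : ℕ} (hn : n < 2 ^ k) (hF : F < 2 ^ k) :
    (n < 2 ^ (k - 1) + 1 ∧ n * 2 ^ k + F * 2 ^ k < n * n + F * F + 2 ^ (2 * (k - 1))) ↔ (n : ℝ) < 2 ^ k * ((1 - sTil k F) / 2) := by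
  obtain ⟨k', rfl⟩ := Nat.exists_eq_add_of_le hk
  simp only [Nat.add_sub_cancel_left]
  set K : ℝ := (2 : ℝ) ^ k' with hK
  have hK0 : 0 < K := by positivity
  have h2k : (2 : ℝ) ^ (1 + k') = 2 * K := by rw [pow_add, pow_one]
  have h4k : ((2 : ℕ) ^ (2 * k') : ℝ) = K ^ 2 := by push_cast; rw [hK, ← pow_mul, mul_comm]
  -- `c = K − F`, `K² s̃² = K² − c²`, `K(1 − s̃) = K − √(K² − c²)`
  have hc2 : (K - F) ^ 2 ≤ K ^ 2 := by
    have hF' : (F : ℝ) < 2 * K := by rw [← h2k]; exact_mod_cast hF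
    have hF0 : (0 : ℝ) ≤ F := Nat.cast_nonneg F
    nlinarith
  have hs : 2 ^ (1 + k') * ((1 - sTil (1 + k') F) / 2) = K - Real.sqrt (K ^ 2 - (K - F) ^ 2) := by
    rw [h2k, sTil, aTil, h2k]
    have e1 : 1 - (1 - 2 * (F : ℝ) / (2 * K)) ^ 2 = (K ^ 2 - (K - F) ^ 2) / K ^ 2 := by field_simp
    rw [e1, Real.sqrt_div' _ (by positivity), Real.sqrt_sq hK0.le]
    field_simp
  rw [hs]
  have hR : (0 : ℝ) ≤ K ^ 2 - (K - F) ^ 2 := by linarith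
  -- cast the integer condition
  have hcast : (n * 2 ^ (1 + k') + F * 2 ^ (1 + k') < n * n + F * F + 2 ^ (2 * k')) ↔
      ((n : ℝ) * (2 * K) + F * (2 * K) < n * n + F * F + K ^ 2) := by
    rw [← h2k, ← h4k]; exact_mod_cast Iff.rfl
  have hn1 : (n < 2 ^ k' + 1) ↔ ((n : ℝ) ≤ K) := by
    rw [Nat.lt_succ_iff, hK]; exact_mod_cast Iff.rfl
  rw [hcast, hn1]
  constructor
  · rintro ⟨hnK, hq⟩
    -- `(K − n)² > K² − c²` with `K − n ≥ 0`
    have hq' : Real.sqrt (K ^ 2 - (K - F) ^ 2) < K - n := by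
      rw [Real.sqrt_lt' (by nlinarith [hq])]
      nlinarith
    linarith
  · intro h
    have hsq := Real.sqrt_nonneg (K ^ 2 - (K - F) ^ 2)
    have hnK : (n : ℝ) ≤ K := by linarith
    refine ⟨hnK, ?_⟩
    have h1 : Real.sqrt (K ^ 2 - (K - F) ^ 2) < K - n := by linarith
    have h2 : K ^ 2 - (K - F) ^ 2 < (K - n) ^ 2 := by
      have := Real.sq_sqrt hR
      nlinarith [Real.sqrt_nonneg (K ^ 2 - (K - F) ^ 2)]
    nlinarith

/-- **Semantics of `sOffB`**: the threshold `n < 2^k·(1 − s̃)/2`. [cite: GroverRudolph2002, eq. (5)] -/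
theorem sOffB_eval_iff {k : ℕ} (hk : 1 ≤ k) (o : ℕ) (bb zt : Bool) (rest : ℕ) {n : ℕ} (hn : n < 2 ^ k) :
    (sOffB k o).eval (2 ^ k * hiOf bb zt rest + n) = decide ((n : ℝ) < 2 ^ k * ((1 - sTil k (fieldVal k o rest)) / 2)) := by
  rw [sOffB_eval k o bb zt rest hn]
  have key := sOff_iff hk hn (fieldVal_lt k o rest)
  by_cases h : (n : ℝ) < 2 ^ k * ((1 - sTil k (fieldVal k o rest)) / 2)
  · obtain ⟨h1, h2⟩ := key.2 h
    rw [decide_eq_true h, decide_eq_true h1, decide_eq_true h2]; rfl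
  · rw [decide_eq_false h]
    by_cases h1 : n < 2 ^ (k - 1) + 1
    · have h2 : ¬ (n * 2 ^ k + fieldVal k o rest * 2 ^ k < n * n + fieldVal k o rest * fieldVal k o rest + 2 ^ (2 * (k - 1))) :=
        fun h2 => h (key.1 ⟨h1, h2⟩)
      rw [decide_eq_true h1, decide_eq_false h2]; rfl
    · rw [decide_eq_false h1]; rfl

/-- **`sOffB` encodes `s̃` at the label** (`k ≥ 1`). [cite: GroverRudolph2002, eq. (5)] -/
theorem encodesEntryAt_sOffB {k : ℕ} (hk : 1 ≤ k) (o rest : ℕ) : EncodesEntryAt k (sOffB k o) (sTil k (fieldVal k o rest)) rest := by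
  have hs := sTil_mem k (fieldVal k o rest)
  have := encodesEntryAt_of_threshold (k := k) (p := sOffB k o) (τ := (1 - sTil k (fieldVal k o rest)) / 2) (rest := rest)
    (by linarith [hs.2]) (by linarith [hs.1]) (fun bb zt n hn => sOffB_eval_iff hk o bb zt rest hn)
  rwa [show 1 - 2 * ((1 - sTil k (fieldVal k o rest)) / 2) = sTil k (fieldVal k o rest) by ring] at this

/-- Side conditions of `sOffB`. [folklore] -/
theorem sOffB_ok {Wd kIn k o : ℕ} (hk : k + 2 + o + k ≤ kIn) (hkW : 2 * k ≤ Wd) (hk1 : 1 ≤ k) : (sOffB k o).OK Wd kIn := by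
  simp only [sOffB, BExpr.OK, AExpr.OK, aE, shlE, zeroE]
  omega

/-- Intermediate bound of `sOffB`: everything fits in `2k + 3` bits. [folklore] -/
theorem sOffB_maxBnd_lt (k o : ℕ) : (sOffB k o).maxBnd < 2 ^ (2 * k + 3) := by
  have h1 : 2 ^ (k - 1) ≤ 2 ^ k := Nat.pow_le_pow_right (by norm_num) (Nat.sub_le k 1)
  have h2 : 2 ^ (2 * (k - 1)) ≤ 2 ^ (2 * k) := Nat.pow_le_pow_right (by norm_num) (by omega)
  have h3 : 2 ^ (2 * k) = 2 ^ k * 2 ^ k := by rw [two_mul, pow_add]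
  have h4 : 2 ^ (2 * k + 3) = 2 ^ k * 2 ^ k * 8 := by rw [pow_add, two_mul, pow_add]; norm_num
  have hk : 1 ≤ 2 ^ k := Nat.one_le_two_pow
  refine BExpr.maxBnd_lt_of_leaves _ fun e he => ?_
  simp only [sOffB, BExpr.leaves, List.mem_cons, List.mem_append, List.not_mem_nil, or_false, or_assoc] at he
  rcases he with rfl | rfl | rfl | rfl <;> simp only [AExpr.bnd, shlE_bnd, aE_bnd, pow_zero, mul_one] <;> nlinarith

/-! ### The level predicate and its entry bound -/

/-- **The sign predicate of the Grover–Rudolph level rotation** from the single field `F` at offset `o`.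
[cite: GroverRudolph2002, eq. (5)] [cite: Regev2009, Lemma 3.12 (proof)] -/
def grLevelB (k o : ℕ) : BExpr := rotSignB k (trueB (k + 2)) (.not (ltFieldB k o)) (.not (sOffB k o)) (sOffB k o)

/-- The shape of `rotC`. [folklore] -/
theorem rotC_apply_eq (a : ℝ) (x y : Cryptography.QReg 1) :
    rotC a x y = if x 0 = y 0 then (a : ℂ) else if x 0 = true then (Real.sqrt (1 - a ^ 2) : ℂ) else ((-Real.sqrt (1 - a ^ 2) : ℝ) : ℂ) := by
  unfold rotC
  rw [Matrix.of_apply]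
  cases hx : x 0 <;> cases hy : y 0 <;> simp

/-- **The entry bound of the Grover–Rudolph level gadget**: on EVERY label, the gadget quantity is within
`2/2^k` of the entry of `−rotC ã`, `ã = 1 − 2F/2^k` read off the label (`k ≥ 1`).
[cite: GroverRudolph2002, eq. (5)] [cite: AharonovJonesLandau2009, Thm. 4.3] -/
theorem grLevel_entry_bound {k : ℕ} (hk : 1 ≤ k) (o rest : ℕ) (bb zt : Bool) :
    ‖((1 : ℂ) - 2 * (((Finset.range (2 ^ k)).filter fun n =>
        (grLevelB k o).eval (2 ^ k * hiOf bb zt rest + n) = true).card : ℂ) / 2 ^ k) -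
      (-rotC (aTil k (fieldVal k o rest))) (fun _ => bb ^^ zt) (fun _ => zt)‖ ≤ 2 / 2 ^ k := by
  set F := fieldVal k o rest with hFdef
  have hd : EncodesEntryAt k (.not (ltFieldB k o)) (-aTil k F) rest := by
    have := encodesEntryAt_not_ltFieldB k o rest
    rwa [aTil]
  have h10 : EncodesEntryAt k (.not (sOffB k o)) (-sTil k F) rest := (encodesEntryAt_sOffB hk o rest).not
  have h01 : EncodesEntryAt k (sOffB k o) (-(-sTil k F)) rest := by rw [neg_neg]; exact encodesEntryAt_sOffB hk o rest
  have key := rotSign_entry_bound_at k (trueB_readsHigh le_rfl) hd h10 h01 (rotC (aTil k F))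
    (fun x y => by rw [rotC_apply_eq, sTil]) bb zt
  rwa [trueB_eval, if_pos rfl, ← grLevelB] at key

end SLP

end Literature.Computability.QuantumComplexity

end
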